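import Literature.NumberTheory.Transcendental.RoySmallValueEstimatesEndgameProofs
import HarnessLib

/-!
# Route `RoyCriterion`, crux `NguyenRoySmallValueTranslates` (stmt-Schanuel-1051), line `Sketch`
# — stub `stub_exponents`

Registered stub D of the skeleton of line `Sketch` for the crux
`Summit.Schanuel.Schanuel.Theses.RoyCriterion.NguyenRoySmallValueTranslates`: the exponent
bookkeeping closing the sharpened Case 2 of §6 of Nguyen–Roy 2016. At arbitrarily large levels
`D` there would be an auxiliary level `Ds ∈ [1, D]` and a degree `c > 0` with
* (NC) `K₃ D^{ν+σ−1−β} ≤ c²` (non-concentration),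
* (I″) `Ds^σ D^{ν−2} c ≤ K₁ Ds^{2+β−σ}` (Case 2, free form),
* (II) `Ds^{σ−1} ≤ K₂ D^{1+β−ν}`.

Writing `ν = 2 + β − σ + δ`, these are incompatible once `δ (1+2β−σ) > (σ−1)(3−2σ)`:
* from (I″), `c ≤ K₁ Ds^{2+β−2σ} D^{2−ν}`; squaring and using (NC),
  `D^{3ν+σ−5−β} ≤ (K₁²/K₃) Ds^{4+2β−4σ}`;
* from (II) with `q = (4+2β−4σ)/(σ−1) ≥ 0`, `Ds^{4+2β−4σ} = (Ds^{σ−1})^q ≤ K₂^q D^{(1+β−ν) q}`;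
* hence `D^{3ν+σ−5−β} ≤ K D^{(1+β−ν) q}` for arbitrarily large `D`, so
  `3ν+σ−5−β ≤ (1+β−ν) q`, i.e. (multiplying by `σ − 1 > 0`) `δ (1+2β−σ) ≤ (σ−1)(3−2σ)`.

Sibling of `NguyenRoy.case_two_exponent_contradiction'` (same structure and tactics).

## References

* [NguyenRoy2016] N. A. V. Nguyen, D. Roy, IJNT 12 (2016) 1273–1293 = arXiv:1412.5163, §6,
  Case 2 (last paragraph).
-/

-- `Summit.Schanuel.Schanuel.…` is the mandated layout of this single-problem summit (CONVENTIONS §1).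
set_option linter.dupNamespace false

noncomputable section

open Filter Finset
open scoped Classical

namespace Summit.Schanuel.Schanuel.Theorems.NguyenRoySharp

open Literature.NumberTheory.Transcendental
open Literature.NumberTheory.Transcendental.NguyenRoy

/-- **Stub D — exponent bookkeeping of the sharpened Case 2.** With `ν = 2+β−σ+δ`: the three
inequalities available at a non-concentrated Case-2 level — `K₃ D^{ν+σ−1−β} ≤ c²`
(non-concentration, `c = deg Z̃_D`), `Ds^σ D^{ν−2} c ≤ K₁ Ds^{2+β−σ}` (Case 2, free form) and
`Ds^{σ−1} ≤ K₂ D^{1+β−ν}` ((II)), `1 ≤ Ds ≤ D` — cannot hold for arbitrarily large `D` once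
`δ > (σ−1)(3−2σ)/(1+2β−σ)` (eliminate `c`, then `Ds`: `δ(1+2β−σ) ≤ (σ−1)(3−2σ)`). Pure real
arithmetic, sibling of `case_two_exponent_contradiction'`. [cite: NguyenRoy2016, §6, Case 2 (last paragraph)] -/
theorem stub_exponents {σ β ν K₁ K₂ K₃ : ℝ} (hK₁ : 0 < K₁) (hK₂ : 0 < K₂) (hK₃ : 0 < K₃)
    (hσ1 : 1 < σ) (hσ : σ < 3 / 2) (hβ : σ + 1 < β)
    (hν : 2 + β - σ + (σ - 1) * (3 - 2 * σ) / (1 + 2 * β - σ) < ν)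
    (h : ∀ N : ℝ, ∃ D ≥ N, ∃ Ds : ℝ, 1 ≤ Ds ∧ Ds ≤ D ∧ ∃ c : ℝ, 0 < c ∧
      K₃ * D ^ (ν + σ - 1 - β) ≤ c ^ 2 ∧
      Ds ^ σ * D ^ (ν - 2) * c ≤ K₁ * Ds ^ (2 + β - σ) ∧
      Ds ^ (σ - 1) ≤ K₂ * D ^ (1 + β - ν)) :
    False := by
  have hA : 0 < 1 + 2 * β - σ := by linarith [hσ1, hβ]
  have hE : 0 < 4 + 2 * β - 4 * σ := by linarith [hσ, hβ]
  have hs : 0 < σ - 1 := by linarith [hσ1]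
  have hK : 0 < K₁ ^ 2 / K₃ := div_pos (pow_pos hK₁ 2) hK₃
  set q : ℝ := (4 + 2 * β - 4 * σ) / (σ - 1) with hq
  have hq0 : 0 ≤ q := div_nonneg hE.le hs.le
  have hsq : (σ - 1) * q = 4 + 2 * β - 4 * σ := by rw [hq]; field_simp
  -- Main step: `3ν + σ - 5 - β ≤ (1 + β - ν) q` (eliminate `c`, then `Ds`)
  have key : 3 * ν + σ - 5 - β ≤ (1 + β - ν) * q := by
    refine le_of_frequently_rpow_le (K := K₁ ^ 2 / K₃ * K₂ ^ q) fun N => ?_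
    obtain ⟨D, hD, Ds, hDs, -, c, hc, hNC, hI, hII⟩ := h (max N 1)
    have hD1 : 1 ≤ D := le_trans (le_max_right _ _) hD
    have hDpos : 0 < D := by linarith
    have hDspos : 0 < Ds := by linarith
    refine ⟨D, le_trans (le_max_left _ _) hD, ?_⟩
    -- from (I″), cancelling `Ds^σ > 0`: `D^{ν-2} c ≤ K₁ Ds^{2+β-2σ}`
    have h2 : D ^ (ν - 2) * c ≤ K₁ * Ds ^ (2 + β - 2 * σ) := by
      have hYpos : 0 < Ds ^ σ := Real.rpow_pos_of_pos hDspos σ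
      have eY : Ds ^ (2 + β - σ) = Ds ^ σ * Ds ^ (2 + β - 2 * σ) := by
        rw [← Real.rpow_add hDspos]; congr 1; ring
      refine le_of_mul_le_mul_left ?_ hYpos
      calc Ds ^ σ * (D ^ (ν - 2) * c) = Ds ^ σ * D ^ (ν - 2) * c := by ring
        _ ≤ K₁ * Ds ^ (2 + β - σ) := hI
        _ = Ds ^ σ * (K₁ * Ds ^ (2 + β - 2 * σ)) := by rw [eY]; ring
    -- hence `c ≤ K₁ Ds^{2+β-2σ} D^{2-ν}`
    have h3 : c ≤ K₁ * Ds ^ (2 + β - 2 * σ) * D ^ (2 - ν) := by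
      have hXpos : 0 < D ^ (2 - ν) := Real.rpow_pos_of_pos hDpos _
      have hX : D ^ (2 - ν) * D ^ (ν - 2) = 1 := by
        rw [← Real.rpow_add hDpos, show (2 - ν) + (ν - 2) = 0 by ring, Real.rpow_zero]
      calc c = D ^ (2 - ν) * (D ^ (ν - 2) * c) := by rw [← mul_assoc, hX, one_mul]
        _ ≤ D ^ (2 - ν) * (K₁ * Ds ^ (2 + β - 2 * σ)) := mul_le_mul_of_nonneg_left h2 hXpos.le
        _ = K₁ * Ds ^ (2 + β - 2 * σ) * D ^ (2 - ν) := by ring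
    -- square and use (NC): `K₃ D^{ν+σ-1-β} ≤ K₁² Ds^{4+2β-4σ} D^{4-2ν}`
    have h4 : K₃ * D ^ (ν + σ - 1 - β) ≤
        K₁ ^ 2 * Ds ^ (4 + 2 * β - 4 * σ) * D ^ (4 - 2 * ν) := by
      have eDs : Ds ^ (2 + β - 2 * σ) * Ds ^ (2 + β - 2 * σ) = Ds ^ (4 + 2 * β - 4 * σ) := by
        rw [← Real.rpow_add hDspos]; congr 1; ring
      have eD : D ^ (2 - ν) * D ^ (2 - ν) = D ^ (4 - 2 * ν) := by
        rw [← Real.rpow_add hDpos]; congr 1; ring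
      calc K₃ * D ^ (ν + σ - 1 - β) ≤ c ^ 2 := hNC
        _ ≤ (K₁ * Ds ^ (2 + β - 2 * σ) * D ^ (2 - ν)) ^ 2 := pow_le_pow_left₀ hc.le h3 2
        _ = K₁ ^ 2 * (Ds ^ (2 + β - 2 * σ) * Ds ^ (2 + β - 2 * σ)) *
              (D ^ (2 - ν) * D ^ (2 - ν)) := by ring
        _ = K₁ ^ 2 * Ds ^ (4 + 2 * β - 4 * σ) * D ^ (4 - 2 * ν) := by rw [eDs, eD]
    -- divide by `K₃`
    have hV : D ^ (ν + σ - 1 - β) ≤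
        K₁ ^ 2 / K₃ * Ds ^ (4 + 2 * β - 4 * σ) * D ^ (4 - 2 * ν) := by
      rw [mul_assoc, div_mul_eq_mul_div, le_div_iff₀ hK₃]
      calc D ^ (ν + σ - 1 - β) * K₃ = K₃ * D ^ (ν + σ - 1 - β) := by ring
        _ ≤ K₁ ^ 2 * Ds ^ (4 + 2 * β - 4 * σ) * D ^ (4 - 2 * ν) := h4
        _ = K₁ ^ 2 * (Ds ^ (4 + 2 * β - 4 * σ) * D ^ (4 - 2 * ν)) := by ring
    -- from (II): `Ds^{4+2β-4σ} = (Ds^{σ-1})^q ≤ K₂^q D^{(1+β-ν) q}`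
    have hW : Ds ^ (4 + 2 * β - 4 * σ) ≤ K₂ ^ q * D ^ ((1 + β - ν) * q) := by
      have e1 : Ds ^ (4 + 2 * β - 4 * σ) = (Ds ^ (σ - 1)) ^ q := by
        rw [← Real.rpow_mul hDspos.le, hsq]
      have e2 : (Ds ^ (σ - 1)) ^ q ≤ (K₂ * D ^ (1 + β - ν)) ^ q :=
        Real.rpow_le_rpow (Real.rpow_nonneg hDspos.le _) hII hq0
      have e3 : (K₂ * D ^ (1 + β - ν)) ^ q = K₂ ^ q * D ^ ((1 + β - ν) * q) := by
        rw [Real.mul_rpow hK₂.le (Real.rpow_nonneg hDpos.le _), ← Real.rpow_mul hDpos.le]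
      rw [e1]
      exact e2.trans_eq e3
    -- assemble
    have e5 : D ^ (3 * ν + σ - 5 - β) = D ^ (ν + σ - 1 - β) * D ^ (2 * ν - 4) := by
      rw [← Real.rpow_add hDpos]; congr 1; ring
    have hX2 : D ^ (4 - 2 * ν) * D ^ (2 * ν - 4) = 1 := by
      rw [← Real.rpow_add hDpos, show (4 - 2 * ν) + (2 * ν - 4) = 0 by ring, Real.rpow_zero]
    have hZpos : 0 < D ^ (2 * ν - 4) := Real.rpow_pos_of_pos hDpos _
    calc D ^ (3 * ν + σ - 5 - β) = D ^ (ν + σ - 1 - β) * D ^ (2 * ν - 4) := e5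
      _ ≤ K₁ ^ 2 / K₃ * Ds ^ (4 + 2 * β - 4 * σ) * D ^ (4 - 2 * ν) * D ^ (2 * ν - 4) :=
          mul_le_mul_of_nonneg_right hV hZpos.le
      _ = K₁ ^ 2 / K₃ * Ds ^ (4 + 2 * β - 4 * σ) * (D ^ (4 - 2 * ν) * D ^ (2 * ν - 4)) := by
          ring
      _ = K₁ ^ 2 / K₃ * Ds ^ (4 + 2 * β - 4 * σ) := by rw [hX2, mul_one]
      _ ≤ K₁ ^ 2 / K₃ * (K₂ ^ q * D ^ ((1 + β - ν) * q)) :=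
          mul_le_mul_of_nonneg_left hW hK.le
      _ = K₁ ^ 2 / K₃ * K₂ ^ q * D ^ ((1 + β - ν) * q) := by ring
  -- multiply `key` by `σ - 1 > 0`
  have key' : (σ - 1) * (3 * ν + σ - 5 - β) ≤ (1 + β - ν) * (4 + 2 * β - 4 * σ) := by
    calc (σ - 1) * (3 * ν + σ - 5 - β) ≤ (σ - 1) * ((1 + β - ν) * q) :=
          mul_le_mul_of_nonneg_left key hs.le
      _ = (1 + β - ν) * ((σ - 1) * q) := by ring
      _ = (1 + β - ν) * (4 + 2 * β - 4 * σ) := by rw [hsq]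
  -- contradiction with the hypothesis on `ν`: `δ (1+2β−σ) ≤ (σ−1)(3−2σ)` for `δ = ν − (2+β−σ)`
  have hd : (σ - 1) * (3 - 2 * σ) / (1 + 2 * β - σ) < ν - (2 + β - σ) := by linarith [hν]
  rw [div_lt_iff₀ hA] at hd
  have hid : (1 + β - ν) * (4 + 2 * β - 4 * σ) - (σ - 1) * (3 * ν + σ - 5 - β) =
      (σ - 1) * (3 - 2 * σ) - (ν - (2 + β - σ)) * (1 + 2 * β - σ) := by ring
  linarith [key', hd, hid]

end Summit.Schanuel.Schanuel.Theorems.NguyenRoySharp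

end
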